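/- Copyright: the b2b-balaban cell (near-miss cell 7), T⁴-continuum fan-out, lineage t4-ne7b-p1 (node U5c COUNT
member).  Released under the licence of the surrounding project. -/
import Summits.QuantumFields.BalabanUV.T4Continuum.Support.HistoryBankingShrunkLedger82
import Summits.QuantumFields.BalabanUV.T4Continuum.Support.HistoryBankingVolumePlug

/-!
# M5-2e (E5) — THE PER-LEVEL DEAD-BOX LEDGER IN THE END's VARIABLES AND THE M5-2c PLUG AT WEIGHT `cvol82` (owner module
of row NE7b, lineage `t4-ne7b-p1` gen 51; re-open object (α), ruling R-OWNER-51-1 «THE CENSUS READING AFTER VOLUME-3;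
M5-2e COMMISSIONED»; PRE-POSITIONING ONLY)

Summits-side support leaf of the T⁴-continuum cell (rung (B)+1 on a FINITE torus only; NOT infinite volume, NOT the
mass gap, NOT the Clay statement; NOT a proof of the spine estimate NE7b — the cell's OWN estimate, NOT PRINTED, NOT
PROVED).  [folklore] by-name composition: the sibling `HistoryBankingShrunkLedger82.shrunk82_volume_le_lifeCost` (M5-2e
file E4) through M5-2a's shape-blindness lemmas (`HistoryBankingFlatWitness.{dictWT_shape_comp, lifeCost_shape_comp}`) and
M5-2c's plug calculus (`HistoryBankingVolumePlug.{blin_toPGen_eq_birthWT_genT, birthWT_smul,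
pshapeTH_mul_exp_le_shapeTH_of_weighted}`) — M5-2d's `HistoryBankingShrunkWitness` with the volume displays of M5-2e;
nothing printed is asserted, no cite-tagged hypothesis, no `def`, zero `sorry`.

v1.1 (APPEND-ONLY; §1–§3 byte-identical): §4 `HistoryBankingShrunkLedger82.shrunk82_volume_le_lifeCost_param` — the
calibration parameter `lam > 2` (floor display `(2·lam∕(lam−2))·collar82 d`, young-birth displays `5·lam`∕`8·lam·126^d`, same
conclusion; `lam = 3` = (E4)'s calibrated form), a LEVER, not consumed by the record of record.

WHAT.  The four theorems of `HistoryBankingShrunkWitness` with M5-2d's volume hypotheses REPLACED by M5-2e's: the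
feedback smallness `hsmall : feed82 d·Γ ≤ 2^j∕2` (was `1122^d·16·21^d·Γ ≤ 2^j∕2`), the LAG-FREE floor display
`huS : u_t·(6·collar82 d) ≤ floorK C K R t` (was `u_t·(6·1122^d)`; `6·collar82 4 = 6 064 368 750` vs
`6·1122⁴ = 9 508 733 552 736`) and the class weight `cvol82 d j Γ` (was `cvol d j Γ`); `hΓ0`, the cumulative growth
`hΓ : u_n ≤ Γ·u_t` (`t ≤ n`), `hj1`, `huE₂`, `huE₃` unchanged: **`shrunk82_volume_le_lifeCost_genT`** (the `genT`
headline), **`exp_volume_le_genT_shrunk82`**, **`credit_mul_volume_le_pshapeTH_costT_shrunk82`**, and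
**`credit_mul_volume_le_shapeTH_shrunk82`** — under `C.a + θᵥ ≤ ½γ₀A₁²` and the volume-slack display
**`cvol82 d j Γ·u_j ≤ θᵥ·p₀(g_j)²`** at the births of `genT c`, print's credit prefactor times the live volume factor is
below `shapeTH Prod.fst C Δ Λ′ R g K 0 (genT c)` — conclusion VERBATIM `credit_mul_volume_le_shapeTH`'s (and M5-2d's
`credit_mul_volume_le_shapeTH_shrunk`'s).  The record twin (the (α) assembly's volume fields at these displays) and the
supplier at print's letters (`VolumeDisplaysS82`) are NOT here (custodian ∕ leaf-06, by INTERFACE REQUEST IR-51-1∕D-51-1).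
CENSUS NOTE (the OWNER's reading R-OWNER-51-1, desk floats for balaban-calc «VOLUME-4»; not a kernel fact): under reading
(A) the lattice floor-exchange threshold is `361.46·ρ` (`ρ = cΛ∕c_{E₂}` unvalued) — census-NIL iff `ρ ≤ 1.21` (m′ = 1) …
`1.56` (m′ = 6), NIL at ratio one; M5-2d's was `5.67·10⁵·ρ`.

HONEST: the lineage's own bookkeeping; NE7b NOT proved; spine 0∕9.  HONEST DEPENDENCY (cell): continuum YM on T⁴ ⇐
BetaPertH ∧ nine spine estimates (0∕9 proved); BetaPertH ⇐ (D1) ∧ (D4) ∧ CAP+tail; G-an2-4 gates asym, D1 and NE2∕3∕4.  This file changes none of it.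
-/

open Finset
open Literature.MathematicalPhysics.QuantumFieldTheory.Balaban1983to89
open Literature.MathematicalPhysics.QuantumFieldTheory.Balaban1983to89.B13ScaleTransfer
open Literature.MathematicalPhysics.QuantumFieldTheory.Balaban1983to89.B16SProfile
open T4PersistenceDictionary T4PrintedShapeBanking T4TaggedShapeBanking T4BankedInduction T4BranchingRecordsGas
open T4PartnerMultiplicity
open Summit.QuantumFields.BalabanUV.T4Continuum.LateMergers
open Summit.QuantumFields.BalabanUV.T4Continuum.HistoryConstants
open Summit.QuantumFields.BalabanUV.T4Continuum.HistoryAdmissible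
open Summit.QuantumFields.BalabanUV.T4Continuum.HistoryRealise
open Summit.QuantumFields.BalabanUV.T4Continuum.HistoryRealiseWeak
open Summit.QuantumFields.BalabanUV.T4Continuum.HistoryGen
open Summit.QuantumFields.BalabanUV.T4Continuum.HistoryBankingPedigreeLedger
open Summit.QuantumFields.BalabanUV.T4Continuum.HistoryBankingBirthBookings
open Summit.QuantumFields.BalabanUV.T4Continuum.HistoryBankingFlatJunction
open Summit.QuantumFields.BalabanUV.T4Continuum.HistoryBankingFlatWitness
open Summit.QuantumFields.BalabanUV.T4Continuum.HistoryBankingVolumePlug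
open Summit.QuantumFields.BalabanUV.T4Continuum.HistoryBankingAnchors82
open Summit.QuantumFields.BalabanUV.T4Continuum.HistoryBankingShrunkLedger82

namespace Summit.QuantumFields.BalabanUV.T4Continuum.HistoryBankingShrunkWitness82

noncomputable section

variable {d : ℕ} {L : ℕ} {s R : ℕ → ℕ} {C : T4PrintedShapeBanking.Consts} {α π : Type*} [DecidableEq α]
  [DecidableEq π]

/-! ## §1 The headline in the END's variables -/

/-- **THE PER-LEVEL DEAD-BOX LEDGER FOR A LIVE COMPONENT OF A TERM's PEDIGREE** (M5-2e; the `genT` form of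
`shrunk82_volume_le_lifeCost`, hypotheses as `flat_volume_le_lifeCost_genT`'s with the volume displays replaced):
`Σ_{m≤K} u_m·compSum id (Pd.toPGen cell c) m ≤ lifeCost (dictWT Prod.fst R C.n₁) (costT Prod.fst C K R) (Pd.genT c)
+ cvol82 d j Γ·blin u (Pd.toPGen cell c)`. [folklore] -/
theorem shrunk82_volume_le_lifeCost_genT (hL : 4 ≤ L) (hdrop : ∀ m, DropCtl s m) (hR : ∀ t, 1 ≤ R t)
    (hn₁ : 13 ≤ C.n₁) (hE₂ : 0 ≤ C.E₂) (hE₃ : 0 ≤ C.E₃) (Pd : Pedigree α π)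
    (cell : π → Pt d × Finset (Pt d)) (hS : ∀ c c', Part.old c' true ∈ Pd.parts c → Pd.step c' + 1 = Pd.step c)
    (c : α) {Z : Finset (Pt d)} (hP : RealisesW L s R (Pd.toPGen cell c) Z)
    (hW : (Pd.genT c).WF (dictWT Prod.fst R C.n₁)) {K : ℕ} (hPK : (Pd.toPGen cell c).lastStep ≤ K)
    (hK : K < (Pd.genT c).reach (dictWT Prod.fst R C.n₁)) {u : ℕ → ℝ} (hu : ∀ n, 0 ≤ u n) {Γ : ℝ}
    (hΓ0 : 0 ≤ Γ) (hΓ : ∀ t n, t ≤ n → u n ≤ Γ * u t) {j : ℕ} (hj1 : 1 ≤ j)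
    (hsmall : feed82 d * Γ ≤ 2 ^ j / 2)
    (huS : ∀ t, t ≤ K → u t * (6 * collar82 d) ≤ floorK C K R t)
    (huE₂ : ∀ n, n ≤ K → u n * (15 * 126 ^ d) ≤ C.E₂ * (R n : ℝ) ^ C.q')
    (huE₃ : ∀ n, n ≤ K → u n * (24 * 126 ^ d) ≤ C.E₃ * (R n : ℝ) ^ C.q') :
    ∑ m ∈ Finset.range (K + 1), u m * compSum L s (fun v => (v : ℝ)) (Pd.toPGen cell c) m ≤
      lifeCost (dictWT Prod.fst R C.n₁) (costT Prod.fst C K R) (Pd.genT c) + cvol82 d j Γ * blin u (Pd.toPGen cell c) := by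
  classical
  have hsh : relabel (shape ∘ Prod.fst) (Pd.genT c) = (Pd.toPGen cell c).toGen := Pd.shape_genT_eq_toGen cell hS c
  have hW' : (Pd.genT c).WF (dictWT (shape ∘ Prod.fst) R C.n₁) := by rw [dictWT_shape_comp]; exact hW
  have hK' : K < (Pd.genT c).reach (dictWT (shape ∘ Prod.fst) R C.n₁) := by rw [dictWT_shape_comp]; exact hK
  have h := shrunk82_volume_le_lifeCost (sh := shape ∘ Prod.fst) hL hdrop hR hn₁ hE₂ hE₃ hP hsh hW' hPK hK' hu hΓ0 hΓ hj1
    hsmall huS huE₂ huE₃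
  rwa [lifeCost_shape_comp] at h

/-! ## §2 The plug: the live volume factor in the booked-cost currency, `κ := costT`, weight `cvol82` -/

/-- **THE LIVE VOLUME FACTOR IN THE BOOKED-COST CURRENCY** (per-level dead-box ledger): `exp (Σ_{m≤K} u_m·compSum id (toPGen cell
c) m) ≤ exp (lifeCost …) · exp (birthWT Prod.fst (cvol82 d j Γ·u) (genT c))`. [folklore] -/
theorem exp_volume_le_genT_shrunk82 (hL : 4 ≤ L) (hdrop : ∀ m, DropCtl s m) (hR : ∀ t, 1 ≤ R t)
    (hn₁ : 13 ≤ C.n₁) (hE₂ : 0 ≤ C.E₂) (hE₃ : 0 ≤ C.E₃) (Pd : Pedigree α π)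
    (cell : π → Pt d × Finset (Pt d)) (hS : ∀ c c', Part.old c' true ∈ Pd.parts c → Pd.step c' + 1 = Pd.step c)
    (c : α) {Z : Finset (Pt d)} (hP : RealisesW L s R (Pd.toPGen cell c) Z)
    (hW : (Pd.genT c).WF (dictWT Prod.fst R C.n₁)) {K : ℕ} (hPK : (Pd.toPGen cell c).lastStep ≤ K)
    (hK : K < (Pd.genT c).reach (dictWT Prod.fst R C.n₁)) {u : ℕ → ℝ} (hu : ∀ n, 0 ≤ u n) {Γ : ℝ}
    (hΓ0 : 0 ≤ Γ) (hΓ : ∀ t n, t ≤ n → u n ≤ Γ * u t) {j : ℕ} (hj1 : 1 ≤ j)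
    (hsmall : feed82 d * Γ ≤ 2 ^ j / 2)
    (huS : ∀ t, t ≤ K → u t * (6 * collar82 d) ≤ floorK C K R t)
    (huE₂ : ∀ n, n ≤ K → u n * (15 * 126 ^ d) ≤ C.E₂ * (R n : ℝ) ^ C.q')
    (huE₃ : ∀ n, n ≤ K → u n * (24 * 126 ^ d) ≤ C.E₃ * (R n : ℝ) ^ C.q') :
    Real.exp (∑ m ∈ Finset.range (K + 1), u m * compSum L s (fun v => (v : ℝ)) (Pd.toPGen cell c) m) ≤
      Real.exp (lifeCost (dictWT Prod.fst R C.n₁) (costT Prod.fst C K R) (Pd.genT c)) *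
        Real.exp (birthWT Prod.fst (fun n => cvol82 d j Γ * u n) (Pd.genT c)) := by
  rw [← Real.exp_add, Real.exp_le_exp, birthWT_smul, ← blin_toPGen_eq_birthWT_genT Pd cell hS c hW u]
  exact shrunk82_volume_le_lifeCost_genT hL hdrop hR hn₁ hE₂ hE₃ Pd cell hS c hP hW hPK hK hu hΓ0 hΓ hj1 hsmall huS
    huE₂ huE₃

/-- **THE `priceM` SHAPE WITH `κ := costT`** (per-level dead-box ledger): print's credit prefactor of the live member, times its volume
factor, times the compensating factor `e^{−birthWT Prod.fst (cvol·u) (genT c)}`, is below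
`pshapeTH Prod.fst O C Δ Λ′ R g 0 (costT Prod.fst C K R) (genT c)`. [folklore] -/
theorem credit_mul_volume_le_pshapeTH_costT_shrunk82 (O : PrintedO1s) (Δ Λ' : ℝ) (g : ℕ → ℝ) (hL : 4 ≤ L)
    (hdrop : ∀ m, DropCtl s m) (hR : ∀ t, 1 ≤ R t) (hn₁ : 13 ≤ C.n₁) (hE₂ : 0 ≤ C.E₂) (hE₃ : 0 ≤ C.E₃)
    (Pd : Pedigree α π) (cell : π → Pt d × Finset (Pt d))
    (hS : ∀ c c', Part.old c' true ∈ Pd.parts c → Pd.step c' + 1 = Pd.step c) (c : α) {Z : Finset (Pt d)}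
    (hP : RealisesW L s R (Pd.toPGen cell c) Z) (hW : (Pd.genT c).WF (dictWT Prod.fst R C.n₁)) {K : ℕ}
    (hPK : (Pd.toPGen cell c).lastStep ≤ K) (hK : K < (Pd.genT c).reach (dictWT Prod.fst R C.n₁)) {u : ℕ → ℝ}
    (hu : ∀ n, 0 ≤ u n) {Γ : ℝ} (hΓ0 : 0 ≤ Γ) (hΓ : ∀ t n, t ≤ n → u n ≤ Γ * u t) {j : ℕ} (hj1 : 1 ≤ j)
    (hsmall : feed82 d * Γ ≤ 2 ^ j / 2)
    (huS : ∀ t, t ≤ K → u t * (6 * collar82 d) ≤ floorK C K R t)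
    (huE₂ : ∀ n, n ≤ K → u n * (15 * 126 ^ d) ≤ C.E₂ * (R n : ℝ) ^ C.q')
    (huE₃ : ∀ n, n ≤ K → u n * (24 * 126 ^ d) ≤ C.E₃ * (R n : ℝ) ^ C.q') :
    0 ≤ Δ → 0 ≤ Λ' →
      Δ * (Λ' ^ partnerAges (PEv.step ∘ Prod.fst) (Pd.genT c) *
          Real.exp (-credits (pcredit O C g ∘ Prod.fst) (Pd.genT c))) *
        Real.exp (∑ m ∈ Finset.range (K + 1), u m * compSum L s (fun v => (v : ℝ)) (Pd.toPGen cell c) m) *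
        Real.exp (-birthWT Prod.fst (fun n => cvol82 d j Γ * u n) (Pd.genT c)) ≤
      pshapeTH Prod.fst O C Δ Λ' R g 0 (costT Prod.fst C K R) (Pd.genT c) := by
  intro hΔ hΛ
  have h := exp_volume_le_genT_shrunk82 hL hdrop hR hn₁ hE₂ hE₃ Pd cell hS c hP hW hPK hK hu hΓ0 hΓ hj1 hsmall huS huE₂
    huE₃
  unfold pshapeTH
  rw [padW_zero]
  have hvol : Real.exp (∑ m ∈ Finset.range (K + 1), u m * compSum L s (fun v => (v : ℝ)) (Pd.toPGen cell c) m) *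
      Real.exp (-birthWT Prod.fst (fun n => cvol82 d j Γ * u n) (Pd.genT c)) ≤
        Real.exp (lifeCost (dictWT Prod.fst R C.n₁) (costT Prod.fst C K R) (Pd.genT c)) := by
    have hB := Real.exp_pos (-birthWT Prod.fst (fun n => cvol82 d j Γ * u n) (Pd.genT c))
    calc _ ≤ Real.exp (lifeCost (dictWT Prod.fst R C.n₁) (costT Prod.fst C K R) (Pd.genT c)) *
          Real.exp (birthWT Prod.fst (fun n => cvol82 d j Γ * u n) (Pd.genT c)) *
          Real.exp (-birthWT Prod.fst (fun n => cvol82 d j Γ * u n) (Pd.genT c)) :=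
        mul_le_mul_of_nonneg_right h hB.le
      _ = _ := by rw [mul_assoc, ← Real.exp_add, add_neg_cancel, Real.exp_zero, mul_one]
  have hpre : 0 ≤ Δ * (Λ' ^ partnerAges (PEv.step ∘ Prod.fst) (Pd.genT c) *
      Real.exp (-credits (pcredit O C g ∘ Prod.fst) (Pd.genT c))) :=
    mul_nonneg hΔ (mul_nonneg (pow_nonneg hΛ _) (Real.exp_pos _).le)
  calc _ = Δ * (Λ' ^ partnerAges (PEv.step ∘ Prod.fst) (Pd.genT c) *
        Real.exp (-credits (pcredit O C g ∘ Prod.fst) (Pd.genT c))) *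
        (Real.exp (∑ m ∈ Finset.range (K + 1), u m * compSum L s (fun v => (v : ℝ)) (Pd.toPGen cell c) m) *
          Real.exp (-birthWT Prod.fst (fun n => cvol82 d j Γ * u n) (Pd.genT c))) := by ring
    _ ≤ Δ * (Λ' ^ partnerAges (PEv.step ∘ Prod.fst) (Pd.genT c) *
        Real.exp (-credits (pcredit O C g ∘ Prod.fst) (Pd.genT c))) *
        Real.exp (lifeCost (dictWT Prod.fst R C.n₁) (costT Prod.fst C K R) (Pd.genT c)) :=
      mul_le_mul_of_nonneg_left hvol hpre
    _ = _ := by ring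

/-- **… AND, UNDER THE VOLUME SLACK AT WEIGHT `cvol82`, BELOW THE TH EXIT'S SHAPE WITHOUT THE COMPENSATING FACTOR**: with
`C.a + θᵥ ≤ ½γ₀A₁²` and the display `cvol82 d j Γ·u_j ≤ θᵥ·p₀(g_j)²` at the births of `genT c`, print's credit prefactor
times the live volume factor is below `shapeTH Prod.fst C Δ Λ′ R g K 0 (genT c)` — conclusion VERBATIM
`HistoryBankingVolumePlug.credit_mul_volume_le_shapeTH`'s (and M5-2d's `credit_mul_volume_le_shapeTH_shrunk`'s). [folklore] -/
theorem credit_mul_volume_le_shapeTH_shrunk82 {O : PrintedO1s} {θv : ℝ} (hslack : C.a + θv ≤ O.γ₀ * O.A₁ ^ 2 / 2)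
    {Δ Λ' : ℝ} (hΔ : 0 ≤ Δ) (hΛ : 0 ≤ Λ') (g : ℕ → ℝ) (hL : 4 ≤ L) (hdrop : ∀ m, DropCtl s m)
    (hR : ∀ t, 1 ≤ R t) (hn₁ : 13 ≤ C.n₁) (hE₂ : 0 ≤ C.E₂) (hE₃ : 0 ≤ C.E₃) (Pd : Pedigree α π)
    (cell : π → Pt d × Finset (Pt d)) (hS : ∀ c c', Part.old c' true ∈ Pd.parts c → Pd.step c' + 1 = Pd.step c)
    (c : α) {Z : Finset (Pt d)} (hP : RealisesW L s R (Pd.toPGen cell c) Z)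
    (hW : (Pd.genT c).WF (dictWT Prod.fst R C.n₁)) {K : ℕ} (hPK : (Pd.toPGen cell c).lastStep ≤ K)
    (hK : K < (Pd.genT c).reach (dictWT Prod.fst R C.n₁)) {u : ℕ → ℝ} (hu : ∀ n, 0 ≤ u n) {Γ : ℝ}
    (hΓ0 : 0 ≤ Γ) (hΓ : ∀ t n, t ≤ n → u n ≤ Γ * u t) {j : ℕ} (hj1 : 1 ≤ j)
    (hsmall : feed82 d * Γ ≤ 2 ^ j / 2)
    (huS : ∀ t, t ≤ K → u t * (6 * collar82 d) ≤ floorK C K R t)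
    (huE₂ : ∀ n, n ≤ K → u n * (15 * 126 ^ d) ≤ C.E₂ * (R n : ℝ) ^ C.q')
    (huE₃ : ∀ n, n ≤ K → u n * (24 * 126 ^ d) ≤ C.E₃ * (R n : ℝ) ^ C.q')
    (huθ : ∀ e ∈ (Pd.genT c).events, (Prod.fst e).kind = 0 →
      cvol82 d j Γ * u (Prod.fst e).step ≤ θv * p0Profile C.A₀ C.p₀ (g (Prod.fst e).step) ^ 2) :
    Δ * (Λ' ^ partnerAges (PEv.step ∘ Prod.fst) (Pd.genT c) *
          Real.exp (-credits (pcredit O C g ∘ Prod.fst) (Pd.genT c))) *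
        Real.exp (∑ m ∈ Finset.range (K + 1), u m * compSum L s (fun v => (v : ℝ)) (Pd.toPGen cell c) m) ≤
      shapeTH Prod.fst C Δ Λ' R g K 0 (Pd.genT c) := by
  have h1 := credit_mul_volume_le_pshapeTH_costT_shrunk82 O Δ Λ' g hL hdrop hR hn₁ hE₂ hE₃ Pd cell hS c hP hW hPK hK hu
    hΓ0 hΓ hj1 hsmall huS huE₂ huE₃ hΔ hΛ
  have h2 := pshapeTH_mul_exp_le_shapeTH_of_weighted (Prod.fst : Lab α π → PEv) hslack hΔ hΛ R g K 0
    (κ := costT Prod.fst C K R) (G := Pd.genT c) (u := fun n => cvol82 d j Γ * u n) huθ (fun _ _ => le_rfl)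
  have hB := Real.exp_pos (birthWT Prod.fst (fun n => cvol82 d j Γ * u n) (Pd.genT c))
  have h3 := mul_le_mul_of_nonneg_right h1 hB.le
  rw [mul_assoc _ (Real.exp (-birthWT Prod.fst (fun n => cvol82 d j Γ * u n) (Pd.genT c))), ← Real.exp_add,
    neg_add_cancel, Real.exp_zero, mul_one] at h3
  exact h3.trans h2

/-! ## §3 Numerals at `d = 4` (census letters; the reading is the owner's, the certification balaban-calc's) -/

/-- the class-linear coefficient at `d = 4` in closed form. [folklore] -/
theorem cvol82_four (j : ℕ) (Γ : ℝ) :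
    cvol82 4 j Γ = 128 + 2773380619548 * Γ + 2021456250 * j * Γ ^ 2 + 1482401250 * j * Γ := by
  unfold cvol82; rw [collar82_four]; norm_num

/-! ## §4 The calibration parameter (v1.1, APPEND-ONLY; owner's v20 receipt, lever (ℓ3) — NOT consumed by the record of record) -/

/-- **THE CALIBRATION PARAMETER OF THE PER-LEVEL DEAD-BOX LEDGER.**  For every real `lam > 2`: under the floor display
`u_t·((2·lam∕(lam − 2))·collar82 d) ≤ floorK C K R t` (`t ≤ K`), M5-1a's young-birth displays at `5·lam·126^d` ∕
`8·lam·126^d`, and the remaining hypotheses of `shrunk82_volume_le`, the SAME conclusion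
`Σ_{m≤K} u_m·V(m) ≤ lifeCost … G + cvol82 d j Γ·blin u P` holds — the raw form applied to `lam·u` at
`σ := 2·collar82 d∕(lam − 2)` (`blin` is linear in `u`, so the class weight is NOT inflated).  At `lam = 3` this is
`shrunk82_volume_le_lifeCost` verbatim (`6·collar82 d`, `15·126^d`, `24·126^d`); as `lam → ∞` the floor exchange tends to
`2·collar82 d` while the young-birth displays tighten linearly (census: the (WS1) threshold `120.49·lam∕(lam−2)·ρ` against
(WS2)'s `75.12·lam·ρ` at d = 4 — balance at `lam ≈ 3.60`, both `≈ 270.7·ρ`; desk floats, the OWNER's reading, not a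
kernel fact).  Filed as a lever only: the record of record and leaf-06's `VolumeDisplaysS82` stay at `lam = 3`. [folklore] -/
theorem _root_.Summit.QuantumFields.BalabanUV.T4Continuum.HistoryBankingShrunkLedger82.shrunk82_volume_le_lifeCost_param
    {ε : Type*} [DecidableEq ε] {sh : ε → PEv} (hL : 4 ≤ L) (hdrop : ∀ m, DropCtl s m) (hR : ∀ t, 1 ≤ R t)
    (hn₁ : 13 ≤ C.n₁) (hE₂ : 0 ≤ C.E₂) (hE₃ : 0 ≤ C.E₃) {P : PGen (Pt d × Finset (Pt d))} {Z : Finset (Pt d)}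
    (hP : RealisesW L s R P Z) {G : Gen ε} (hsh : relabel sh G = P.toGen) (hW : G.WF (dictWT sh R C.n₁)) {K : ℕ}
    (hPK : P.lastStep ≤ K) (hK : K < G.reach (dictWT sh R C.n₁)) {u : ℕ → ℝ} (hu : ∀ n, 0 ≤ u n) {Γ : ℝ}
    (hΓ0 : 0 ≤ Γ) (hΓ : ∀ t n, t ≤ n → u n ≤ Γ * u t) {j : ℕ} (hj1 : 1 ≤ j)
    (hsmall : feed82 d * Γ ≤ 2 ^ j / 2) {lam : ℝ} (hlam : 2 < lam)
    (huS : ∀ t, t ≤ K → u t * (2 * lam / (lam - 2) * collar82 d) ≤ floorK C K R t)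
    (huE₂ : ∀ n, n ≤ K → u n * (5 * lam * 126 ^ d) ≤ C.E₂ * (R n : ℝ) ^ C.q')
    (huE₃ : ∀ n, n ≤ K → u n * (8 * lam * 126 ^ d) ≤ C.E₃ * (R n : ℝ) ^ C.q') :
    ∑ m ∈ Finset.range (K + 1), u m * compSum L s (fun v => (v : ℝ)) P m ≤
      lifeCost (dictWT sh R C.n₁) (costT sh C K R) G + cvol82 d j Γ * blin u P := by
  have hc := collar82_pos d
  have hl2 : 0 < lam - 2 := by linarith
  have hl0 : 0 < lam := by linarith
  set σ : ℝ := 2 * collar82 d / (lam - 2) with hσdef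
  have hσ : 0 < σ := by rw [hσdef]; positivity
  have hu' : ∀ n, 0 ≤ lam * u n := fun n => mul_nonneg hl0.le (hu n)
  have hΓ' : ∀ t n, t ≤ n → lam * u n ≤ Γ * (lam * u t) := fun t n htn => by
    have := mul_le_mul_of_nonneg_left (hΓ t n htn) hl0.le
    linarith [this]
  have hσid : lam * σ = 2 * lam / (lam - 2) * collar82 d := by
    rw [hσdef]; field_simp
  have huS' : ∀ t, t ≤ K → lam * u t * σ ≤ floorK C K R t := fun t ht => by
    have e : lam * u t * σ = u t * (2 * lam / (lam - 2) * collar82 d) := by rw [← hσid]; ring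
    rw [e]; exact huS t ht
  have huE₂' : ∀ n, n ≤ K → lam * u n * (5 * 126 ^ d) ≤ C.E₂ * (R n : ℝ) ^ C.q' := fun n hn => by
    have e : lam * u n * (5 * 126 ^ d) = u n * (5 * lam * 126 ^ d) := by ring
    rw [e]; exact huE₂ n hn
  have huE₃' : ∀ n, n ≤ K → lam * u n * (8 * 126 ^ d) ≤ C.E₃ * (R n : ℝ) ^ C.q' := fun n hn => by
    have e : lam * u n * (8 * 126 ^ d) = u n * (8 * lam * 126 ^ d) := by ring
    rw [e]; exact huE₃ n hn
  have h := shrunk82_volume_le (u := fun n => lam * u n) hL hdrop hR hn₁ hE₂ hE₃ hP hsh hW hPK hK hu' hΓ0 hΓ' hj1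
    hsmall hσ huS' huE₂' huE₃'
  have hcoef : (2 + 2 * collar82 d / σ : ℝ) = lam := by
    rw [hσdef]; field_simp; ring
  rw [hcoef] at h
  have hb : blin (fun n => lam * u n) P = lam * blin u P := blin_smul lam u P
  have hs : ∑ m ∈ Finset.range (K + 1), lam * u m * compSum L s (fun v => (v : ℝ)) P m =
      lam * ∑ m ∈ Finset.range (K + 1), u m * compSum L s (fun v => (v : ℝ)) P m := by
    rw [Finset.mul_sum]; exact Finset.sum_congr rfl fun m _ => by ring
  rw [hb, hs] at h
  have h' : lam * ∑ m ∈ Finset.range (K + 1), u m * compSum L s (fun v => (v : ℝ)) P m ≤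
      lam * (lifeCost (dictWT sh R C.n₁) (costT sh C K R) G + cvol82 d j Γ * blin u P) := by
    unfold cvol82; linarith [h]
  exact le_of_mul_le_mul_left h' hl0

end

end Summit.QuantumFields.BalabanUV.T4Continuum.HistoryBankingShrunkWitness82
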